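import Summits.ResolutionOfSingularities.ResolutionOfSingularities.Theorems.EquisingularLiftEquisingularLiftNatCentredPackageFrameAxis
import Summits.ResolutionOfSingularities.ResolutionOfSingularities.Theorems.EquisingularLiftEquisingularLiftNatConeDeltaPlaneChartsOver
import HarnessLib

/-!
# [OURS · L1 W4.5(b) · EL♮(3)] (δ) D4 scheme half — `TCPlus.CentredPackage` at a cone point from the POINTED plane chart clauses
# (B6c ★ T-PKG-FRAME p545513 / p546375 verbatim, with regularity of `Λ[X,Y]/(Φu)`, `Λ[X,Y]/(Φv)` asked only at the primes over the point)
# (crux `EquisingularLiftNatThree` stmt-ResolutionOfSingularities-20148 / parent 20038; rung v7′ TC⁺⁺, STEP 0 per subset)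

NOT a statement of any manuscript. Helper file of the chain res-L1-w45b (cell `res-hironaka`, LADDER-RESOLUTION rung L, slot W4.5(b));
OURS; AI-written, weaker than expert review; `--supports stmt-ResolutionOfSingularities-20148 --as helper` by res-L1-w45b-stub-3 (brick D4,
scheme half, of `L/res-L1-w45b-stub-3/DELTA-PLAN.md`). No `sorry`; standard axioms. It closes nothing by itself.

WHAT. At a point `t` of a CLUSTER the cone `Φ_S` of (δ) D1 (`exists_clusterConeLift_subset`, …NatClusterConeSubset) has regular strict
transforms only at the primes containing `C ϖ` AND the exceptional variable (the infinitely-near points of THAT cluster point); B6c ★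
(`tcPlus_centredPackage_of_presentation` p545513, `tcPlus_centredPackage_of_axisSection` p546375) asked for regularity at every prime
containing `C ϖ` because its B7★ input did. With the pointed B7★ chain (…NatConeDeltaPlaneChartsOver,
`coneDeltaRegular_of_chartPresentation_over`) the two B6c theorems go through VERBATIM under the pointed hypotheses:
* `tcPlus_centredPackage_of_presentation_over`,
* **`tcPlus_centredPackage_of_axisSection_over`** — the per-point `TCPlus.CentredPackage` of (δ) D4 in the currency of res-D-pv-029's
  B6b glue `exists_axisSection_conePoint` (p545343), to be applied in the frame ADAPTED to the cluster point ((δ) D2).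

References: res-L1-w45b-stub-3 p545513, p546375, p540595 and …NatConeDeltaPlaneChartsOver; res-type-100 B6a p541628; res-D-pv-029 B6b
p545343. H. Matsumura, *Commutative Ring Theory* (1986), Thm. 14.2 [cite: Matsumura1987]; U. Görtz, T. Wedhorn, *Algebraic Geometry I* (2020),
Prop. 13.91 p. 414 [cite: GortzWedhorn2020].
-/

set_option linter.dupNamespace false -- mandated namespace `Summit.<Summit>.<Problem>` of this single-conjunct summit
set_option linter.overlappingInstances false -- signatures carry `[IsDomain O] [IsDiscreteValuationRing O]`

noncomputable section

open CategoryTheory CategoryTheory.Limits AlgebraicGeometry TopologicalSpace IsLocalRing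
open Literature.AlgebraicGeometry.Resolution
open AlgebraicGeometry.Scheme.IdealSheafData

namespace Summit.ResolutionOfSingularities.ResolutionOfSingularities.Cruxes.EquisingularLiftNat.Sections.TCPlus

/-- **(δ) D4 — B6c ★ T-PKG-FRAME under the POINTED chart clauses**: as `tcPlus_centredPackage_of_presentation` (p545513) with the
regularity of the local rings of `O[X,Y]/(Φu)`, `O[X,Y]/(Φv)` asked only at the primes containing `C ϖ` and `X 0` (resp. `X 1`).
[cite: Matsumura1987, Thm. 14.2] [OURS · L1 W4.5b] (δ) D4; NOT a statement of the manuscript. -/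
theorem tcPlus_centredPackage_of_presentation_over (O : Type) [CommRing O] [IsDomain O] [IsDiscreteValuationRing O] (ϖ : O) (hϖ : Irreducible ϖ)
    (P : Scheme.{0}) (q : P ⟶ Spec (.of O)) {X' X₁ : Scheme.{0}} [IsLocallyNoetherian X₁] (σ' : X' ⟶ P)
    (r' : X' ⟶ Spec (.of O)) {J : X'.IdealSheafData} {τ₁ : X₁ ⟶ X'} [IsSeparated ((τ₁ ≫ σ') ≫ q)] (K₀ : X'.IdealSheafData)
    -- the cone point over the old centre, and the section frame there (B4a)
    (p₁ : X₁) (p : X') (hpc : τ₁ p₁ = p) (hpJ : p ∈ (J.support : Set X'))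
    (c : Fin 3 → X'.presheaf.stalk p) (hcJ : Ideal.span (Set.range c) = stalkIdeal J p) (hc : IsQuasiRegular c)
    (θR : (X'.presheaf.stalk p ⧸ Ideal.span (Set.range c)) ≃+* O)
    (hθR : ∀ b : O, θR (Ideal.Quotient.mk _
      (((Scheme.ΓSpecIso (.of O)).inv ≫ r'.appTop ≫ X'.presheaf.Γgerm p).hom b)) = b)
    (h𝔪R : Ideal.span (Set.range c) ⊔ Ideal.span {((Scheme.ΓSpecIso (.of O)).inv ≫ r'.appTop ≫ X'.presheaf.Γgerm p).hom ϖ} =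
      maximalIdeal (X'.presheaf.stalk p))
    -- the chart-`0` presentation of `𝒪_{X₁,p₁}` (B6a)
    (𝔔₁ : PrimeSpectrum (blowupAlgebra (Ideal.span (Set.range c)) (c 0)))
    (χ₁ : blowupAlgebra (Ideal.span (Set.range c)) (c 0) →+* X₁.presheaf.stalk p₁)
    (hχ₁ : ∀ a, χ₁ (algebraMap _ _ a) = ((X'.presheaf.stalkCongr (Inseparable.of_eq hpc)).inv ≫ τ₁.stalkMap p₁).hom a)
    (hloc₁ : @IsLocalization.AtPrime _ _ (X₁.presheaf.stalk p₁) _ χ₁.toAlgebra 𝔔₁.asIdeal _)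
    (h𝔔₁ : 𝔔₁.asIdeal.comap (algebraMap _ (blowupAlgebra (Ideal.span (Set.range c)) (c 0))) = maximalIdeal (X'.presheaf.stalk p))
    (hu : ∀ l : Fin 3, l ≠ 0 → χ₁ (blowupAlgebra.frac c 0 l) ∈ maximalIdeal (X₁.presheaf.stalk p₁))
    (hreg₁ : IsRegularLocalRing (X₁.presheaf.stalk p₁))
    (hdim₁ : ringKrullDim (X₁.presheaf.stalk p₁) = ((3 + 1 : ℕ) : WithBot ℕ∞))
    -- the axis section (B6b at `C := C_axis ⊔ St K₀`)
    (sc : Spec (.of O) ⟶ X₁) (hsc : sc ≫ (τ₁ ≫ σ') ≫ q = 𝟙 _) (hscp : sc (closedPoint O) = p₁)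
    (hle : J.comap τ₁ ⊔ strictTransformIdeal τ₁ J K₀ ≤ sc.ker)
    (hker : stalkIdeal sc.ker p₁ = (Ideal.span {algebraMap _ (blowupAlgebra (Ideal.span (Set.range c)) (c 0)) (c 0)} ⊔
      Ideal.span {blowupAlgebra.frac c 0 1, blowupAlgebra.frac c 0 2}).map χ₁)
    -- the centred form (B4a)
    {d m : ℕ} (Φ : MvPolynomial (Fin 3) O) (h1m : 1 ≤ m) (hΦd : Φ.IsHomogeneous d) (hcen : ∀ α ∈ Φ.support, m ≤ α 1 + α 2)
    (hexact : ∃ α ∈ Φ.support, α 1 + α 2 = m ∧ Φ.coeff α ∉ maximalIdeal O)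
    (hΦc : MvPolynomial.map (Ideal.Quotient.mk (Ideal.span (Set.range c)))
      (MvPolynomial.map ((Scheme.ΓSpecIso (.of O)).inv ≫ r'.appTop ≫ X'.presheaf.Γgerm p).hom Φ) ≠ 0)
    (hK₀ : stalkIdeal K₀ p = Ideal.span {MvPolynomial.eval c
      (MvPolynomial.map ((Scheme.ΓSpecIso (.of O)).inv ≫ r'.appTop ≫ X'.presheaf.Γgerm p).hom Φ)})
    (Φu Φv : MvPolynomial (Fin 2) O)
    (hΦu : MvPolynomial.aeval (![1, MvPolynomial.X 0, MvPolynomial.X 0 * MvPolynomial.X 1] : Fin 3 → MvPolynomial (Fin 2) O) Φ =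
      MvPolynomial.X 0 ^ m * Φu)
    (hΦv : MvPolynomial.aeval (![1, MvPolynomial.X 0 * MvPolynomial.X 1, MvPolynomial.X 1] : Fin 3 → MvPolynomial (Fin 2) O) Φ =
      MvPolynomial.X 1 ^ m * Φv)
    (hregu : ∀ (Q : Ideal (MvPolynomial (Fin 2) O ⧸ Ideal.span {Φu})) [Q.IsPrime],
      Ideal.Quotient.mk (Ideal.span {Φu}) (MvPolynomial.C ϖ : MvPolynomial (Fin 2) O) ∈ Q →
      Ideal.Quotient.mk (Ideal.span {Φu}) (MvPolynomial.X 0 : MvPolynomial (Fin 2) O) ∈ Q →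
      IsRegularLocalRing (Localization.AtPrime Q))
    (hregv : ∀ (Q : Ideal (MvPolynomial (Fin 2) O ⧸ Ideal.span {Φv})) [Q.IsPrime],
      Ideal.Quotient.mk (Ideal.span {Φv}) (MvPolynomial.C ϖ : MvPolynomial (Fin 2) O) ∈ Q →
      Ideal.Quotient.mk (Ideal.span {Φv}) (MvPolynomial.X 1 : MvPolynomial (Fin 2) O) ∈ Q →
      IsRegularLocalRing (Localization.AtPrime Q)) :
    CentredPackage O P q X₁ (τ₁ ≫ σ') (J.comap τ₁) (strictTransformIdeal τ₁ J K₀) p₁ := by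
  classical
  -- notation: `ι : O → 𝒪_{X′,p}` the structure germs
  set ι : O →+* X'.presheaf.stalk p := ((Scheme.ΓSpecIso (.of O)).inv ≫ r'.appTop ≫ X'.presheaf.Γgerm p).hom with hι
  haveI : IsDomain (X'.presheaf.stalk p ⧸ Ideal.span (Set.range c)) := MulEquiv.isDomain O θR.toMulEquiv
  -- the frame `c′ = (χ₁(c₀/1), χ₁(c₁/c₀), χ₁(c₂/c₀))` at `p₁`
  let u : Fin 2 → X₁.presheaf.stalk p₁ := fun l => χ₁ (blowupAlgebra.frac c 0 l.succ)
  let c' : Fin 3 → X₁.presheaf.stalk p₁ := fun i => Fin.cases (χ₁ (algebraMap _ _ (c 0))) u i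
  have hc'0 : c' 0 = χ₁ (algebraMap _ _ (c 0)) := rfl
  have hc'succ : ∀ l : Fin 2, c' l.succ = χ₁ (blowupAlgebra.frac c 0 l.succ) := fun l => rfl
  have hspan : Ideal.span (Set.range c') = stalkIdeal sc.ker p₁ := by
    rw [hker, Ideal.map_sup, Ideal.map_span, Ideal.map_span, Set.image_singleton, Set.image_pair, span_range_cases_three]
    rfl
  -- the frame clauses from the section (res-type-100 `exists_sectionFrame_of_span_eq_forall_at`)
  have hdim₁' : ringKrullDim (X₁.presheaf.stalk p₁) = (3 + 1 : ℕ) := hdim₁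
  obtain ⟨θ', hc'qr, hdom', -, h𝔪', hϖ'⟩ :=
    exists_sectionFrame_of_span_eq_forall_at O ((τ₁ ≫ σ') ≫ q) sc hsc p₁ hscp hreg₁ ϖ hϖ c' hspan hdim₁'
  have hdim₁'' : ringKrullDim (X₁.presheaf.stalk p₁) = (2 + 2 : ℕ) := hdim₁
  have htail : IsQuasiRegular fun l : Fin 2 => Ideal.Quotient.mk (Ideal.span {c' 0}) (c' l.succ) :=
    isQuasiRegular_tail_of_sup_span_singleton_eq c' _ h𝔪' hdim₁''
  -- the stalks of the carrier and of the cone (res-type-100 F2′)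
  have hιΦd : (MvPolynomial.map ι Φ).IsHomogeneous d := hΦd.map ι
  obtain ⟨hE, hSt, -, -⟩ := stalkIdeal_carrierDelta_of_presentation (τ := τ₁) K₀ p₁ p hpc hpJ c hcJ hc
    (MvPolynomial.map ι Φ) hιΦd hΦc hK₀ 0 𝔔₁ χ₁ hχ₁ hloc₁ h𝔔₁
  -- the regrouped cone form `Φ′`
  have hu' : ∀ l : Fin 2, u l ∈ maximalIdeal (X₁.presheaf.stalk p₁) := fun l => hu l.succ (Fin.succ_ne_zero l)
  have hexact' : ∃ α ∈ Φ.support, α 1 + α 2 = m ∧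
      IsUnit ((χ₁.comp ((algebraMap (X'.presheaf.stalk p) (blowupAlgebra (Ideal.span (Set.range c)) (c 0))).comp ι))
        (Φ.coeff α)) := by
    obtain ⟨α, hα, hαm, hαu⟩ := hexact
    exact ⟨α, hα, hαm, (IsLocalRing.notMem_maximalIdeal.mp hαu).map _⟩
  obtain ⟨Φ', hΦ'd, hΦ'eval, hΦ'𝔪⟩ := exists_regroup_centred
    (χ₁.comp ((algebraMap (X'.presheaf.stalk p) (blowupAlgebra (Ideal.span (Set.range c)) (c 0))).comp ι)) u hu' Φ hΦd hcen hexact'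
  -- `Φ′(u) = χ₁ (Φ_R(c/c₀))`
  have hfun : (fun i => χ₁ (blowupAlgebra.frac c 0 i)) = (![1, u 0, u 1] : Fin 3 → X₁.presheaf.stalk p₁) := by
    funext i
    refine Fin.cases ?_ (fun l => ?_) i
    · rw [show blowupAlgebra.frac c 0 0 = 1 from blowupAlgebra.gen_self _ _ _, map_one]
      rfl
    · have hl : l = 0 ∨ l = 1 := by fin_cases l <;> simp
      rcases hl with rfl | rfl <;> rfl
  have hcone : MvPolynomial.eval u Φ' = χ₁ (MvPolynomial.aeval (blowupAlgebra.frac c 0) (MvPolynomial.map ι Φ)) := by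
    rw [hΦ'eval, MvPolynomial.map_aeval, MvPolynomial.eval₂Hom_map_hom, hfun, MvPolynomial.aeval_def, MvPolynomial.eval₂_map,
      MvPolynomial.coe_eval₂Hom]
    exact congrArg (fun F => MvPolynomial.eval₂ F (![1, u 0, u 1] : Fin 3 → X₁.presheaf.stalk p₁) Φ) (RingHom.ext fun _ => rfl)
  have hK : stalkIdeal (strictTransformIdeal τ₁ J K₀) p₁ = Ideal.span {MvPolynomial.eval (fun l : Fin 2 => c' l.succ) Φ'} := by
    rw [hSt, show (fun l : Fin 2 => c' l.succ) = u from rfl, hcone]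
  -- `Φ′ mod (c′) ≠ 0` from `Φ′ mod 𝔪 ≠ 0`
  have hΦ'c : MvPolynomial.map (Ideal.Quotient.mk (Ideal.span (Set.range c'))) Φ' ≠ 0 :=
    map_quotient_ne_zero_of_map_residue_ne_zero Φ' hΦ'𝔪 _
      (fun h => hϖ' (by rw [h]; exact Submodule.mem_top))
  -- the lift `Φ_R = ι_* Φ` reduces to `Φ` along `θR`, and `θR (ι ϖ) = ϖ`, `ι ϖ ∈ 𝔪_R`
  have hΦR : MvPolynomial.map (θR.toRingHom.comp (Ideal.Quotient.mk (Ideal.span (Set.range c)))) (MvPolynomial.map ι Φ) = Φ := by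
    have hF : (θR.toRingHom.comp (Ideal.Quotient.mk (Ideal.span (Set.range c)))).comp ι = RingHom.id O :=
      RingHom.ext fun b => hθR b
    rw [MvPolynomial.map_map, hF, MvPolynomial.map_id]
  have hϖR : ι ϖ ∈ maximalIdeal (X'.presheaf.stalk p) := by
    rw [← h𝔪R]
    exact Ideal.mem_sup_right (Ideal.mem_span_singleton_self _)
  -- Δ-regularity after the blow-up of the section: B7
  have hΔ : ConeDeltaRegular c' Φ' :=
    coneDeltaRegular_of_chartPresentation_over c hc θR χ₁ 𝔔₁.asIdeal hloc₁ h𝔔₁ c' hc'0 hc'succ _ h𝔪' hdim₁'' Φ' hΦ'd hΦ'𝔪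
      (MvPolynomial.map ι Φ) Φ hΦR (by change Ideal.Quotient.mk _ (MvPolynomial.eval u Φ') = _; rw [hcone]) (ι ϖ) hϖR ϖ (hθR ϖ)
      Φu Φv hΦu hΦv hregu hregv
  -- assemble the package
  exact ⟨sc, hsc, hscp, hle, c', m, Φ', hspan, hc'qr, hdom', htail, hE, h1m, hΦ'd, hK, hΦ'c, hΦ'𝔪, hΔ⟩

/-- **(δ) D4 — B6c ★ in the currency of the B6b glue, under the POINTED chart clauses**: as `tcPlus_centredPackage_of_axisSection`
(p546375) with the pointed regularity hypotheses. [cite: Matsumura1987, Thm. 14.2] [OURS · L1 W4.5b] (δ) D4; NOT a statement of the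
manuscript. -/
theorem tcPlus_centredPackage_of_axisSection_over (O : Type) [CommRing O] [IsDomain O] [IsDiscreteValuationRing O] (ϖ : O)
    (hϖ : Irreducible ϖ) (P : Scheme.{0}) (q : P ⟶ Spec (.of O)) {X' X₁ : Scheme.{0}} [IsLocallyNoetherian X₁] (σ' : X' ⟶ P)
    (r' : X' ⟶ Spec (.of O)) {J : X'.IdealSheafData} {τ₁ : X₁ ⟶ X'} [IsSeparated ((τ₁ ≫ σ') ≫ q)] (K₀ : X'.IdealSheafData)
    (p₁ : X₁) (p : X') (hpc : τ₁ p₁ = p) (hpJ : p ∈ (J.support : Set X'))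
    (c : Fin 3 → X'.presheaf.stalk p) (hcJ : Ideal.span (Set.range c) = stalkIdeal J p) (hc : IsQuasiRegular c)
    (θR : (X'.presheaf.stalk p ⧸ Ideal.span (Set.range c)) ≃+* O)
    (hθR : ∀ b : O, θR (Ideal.Quotient.mk _
      (((Scheme.ΓSpecIso (.of O)).inv ≫ r'.appTop ≫ X'.presheaf.Γgerm p).hom b)) = b)
    (h𝔪R : Ideal.span (Set.range c) ⊔ Ideal.span {((Scheme.ΓSpecIso (.of O)).inv ≫ r'.appTop ≫ X'.presheaf.Γgerm p).hom ϖ} =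
      maximalIdeal (X'.presheaf.stalk p))
    (𝔔₁ : PrimeSpectrum (blowupAlgebra (Ideal.span (Set.range c)) (c 0)))
    (χ₁ : blowupAlgebra (Ideal.span (Set.range c)) (c 0) →+* X₁.presheaf.stalk p₁)
    (hχ₁ : ∀ a, χ₁ (algebraMap _ _ a) = ((X'.presheaf.stalkCongr (Inseparable.of_eq hpc)).inv ≫ τ₁.stalkMap p₁).hom a)
    (hloc₁ : @IsLocalization.AtPrime _ _ (X₁.presheaf.stalk p₁) _ χ₁.toAlgebra 𝔔₁.asIdeal _)
    (h𝔔₁ : 𝔔₁.asIdeal.comap (algebraMap _ (blowupAlgebra (Ideal.span (Set.range c)) (c 0))) = maximalIdeal (X'.presheaf.stalk p))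
    (hu : ∀ l : Fin 3, l ≠ 0 → χ₁ (blowupAlgebra.frac c 0 l) ∈ maximalIdeal (X₁.presheaf.stalk p₁))
    (hreg₁ : IsRegularLocalRing (X₁.presheaf.stalk p₁))
    (hdim₁ : ringKrullDim (X₁.presheaf.stalk p₁) = ((3 + 1 : ℕ) : WithBot ℕ∞))
    -- the axis section: res-D-pv-029's `exists_axisSection_conePoint` outputs (`hE` from its `C_axis ≤ s_c.ker`)
    (sc : Spec (.of O) ⟶ X₁) (hsc : sc ≫ (τ₁ ≫ σ') ≫ q = 𝟙 _) (hscp : sc (closedPoint O) = p₁)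
    (hE : J.comap τ₁ ≤ sc.ker)
    (hker : stalkIdeal sc.ker p₁ = (Ideal.span {algebraMap _ (blowupAlgebra (Ideal.span (Set.range c)) (c 0)) (c 0)} ⊔
      Ideal.span {blowupAlgebra.frac c 0 1, blowupAlgebra.frac c 0 2}).map χ₁)
    {d m : ℕ} (Φ : MvPolynomial (Fin 3) O) (h1m : 1 ≤ m) (hΦd : Φ.IsHomogeneous d) (hcen : ∀ α ∈ Φ.support, m ≤ α 1 + α 2)
    (hexact : ∃ α ∈ Φ.support, α 1 + α 2 = m ∧ Φ.coeff α ∉ maximalIdeal O)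
    (hΦc : MvPolynomial.map (Ideal.Quotient.mk (Ideal.span (Set.range c)))
      (MvPolynomial.map ((Scheme.ΓSpecIso (.of O)).inv ≫ r'.appTop ≫ X'.presheaf.Γgerm p).hom Φ) ≠ 0)
    (hK₀ : stalkIdeal K₀ p = Ideal.span {MvPolynomial.eval c
      (MvPolynomial.map ((Scheme.ΓSpecIso (.of O)).inv ≫ r'.appTop ≫ X'.presheaf.Γgerm p).hom Φ)})
    (Φu Φv : MvPolynomial (Fin 2) O)
    (hΦu : MvPolynomial.aeval (![1, MvPolynomial.X 0, MvPolynomial.X 0 * MvPolynomial.X 1] : Fin 3 → MvPolynomial (Fin 2) O) Φ =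
      MvPolynomial.X 0 ^ m * Φu)
    (hΦv : MvPolynomial.aeval (![1, MvPolynomial.X 0 * MvPolynomial.X 1, MvPolynomial.X 1] : Fin 3 → MvPolynomial (Fin 2) O) Φ =
      MvPolynomial.X 1 ^ m * Φv)
    (hregu : ∀ (Q : Ideal (MvPolynomial (Fin 2) O ⧸ Ideal.span {Φu})) [Q.IsPrime],
      Ideal.Quotient.mk (Ideal.span {Φu}) (MvPolynomial.C ϖ : MvPolynomial (Fin 2) O) ∈ Q →
      Ideal.Quotient.mk (Ideal.span {Φu}) (MvPolynomial.X 0 : MvPolynomial (Fin 2) O) ∈ Q →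
      IsRegularLocalRing (Localization.AtPrime Q))
    (hregv : ∀ (Q : Ideal (MvPolynomial (Fin 2) O ⧸ Ideal.span {Φv})) [Q.IsPrime],
      Ideal.Quotient.mk (Ideal.span {Φv}) (MvPolynomial.C ϖ : MvPolynomial (Fin 2) O) ∈ Q →
      Ideal.Quotient.mk (Ideal.span {Φv}) (MvPolynomial.X 1 : MvPolynomial (Fin 2) O) ∈ Q →
      IsRegularLocalRing (Localization.AtPrime Q)) :
    CentredPackage O P q X₁ (τ₁ ≫ σ') (J.comap τ₁) (strictTransformIdeal τ₁ J K₀) p₁ := by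
  classical
  refine tcPlus_centredPackage_of_presentation_over O ϖ hϖ P q σ' r' K₀ p₁ p hpc hpJ c hcJ hc θR hθR h𝔪R 𝔔₁ χ₁ hχ₁ hloc₁ h𝔔₁ hu hreg₁
    hdim₁ sc hsc hscp (sup_le hE ?_) hker Φ h1m hΦd hcen hexact hΦc hK₀ Φu Φv hΦu hΦv hregu hregv
  -- `St K₀ ≤ ker s_c`: its stalk at `p₁` is a value of a form of degree `m ≥ 1` in the chart coordinates
  haveI : IsDomain (X'.presheaf.stalk p ⧸ Ideal.span (Set.range c)) := MulEquiv.isDomain O θR.toMulEquiv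
  set ι : O →+* X'.presheaf.stalk p := ((Scheme.ΓSpecIso (.of O)).inv ≫ r'.appTop ≫ X'.presheaf.Γgerm p).hom with hι
  obtain ⟨-, hSt, -, -⟩ := stalkIdeal_carrierDelta_of_presentation (τ := τ₁) K₀ p₁ p hpc hpJ c hcJ hc
    (MvPolynomial.map ι Φ) (hΦd.map ι) hΦc hK₀ 0 𝔔₁ χ₁ hχ₁ hloc₁ h𝔔₁
  let u : Fin 2 → X₁.presheaf.stalk p₁ := fun l => χ₁ (blowupAlgebra.frac c 0 l.succ)
  have hu' : ∀ l : Fin 2, u l ∈ maximalIdeal (X₁.presheaf.stalk p₁) := fun l => hu l.succ (Fin.succ_ne_zero l)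
  have hexact' : ∃ α ∈ Φ.support, α 1 + α 2 = m ∧
      IsUnit ((χ₁.comp ((algebraMap (X'.presheaf.stalk p) (blowupAlgebra (Ideal.span (Set.range c)) (c 0))).comp ι))
        (Φ.coeff α)) := by
    obtain ⟨α, hα, hαm, hαu⟩ := hexact
    exact ⟨α, hα, hαm, (IsLocalRing.notMem_maximalIdeal.mp hαu).map _⟩
  obtain ⟨Φ', hΦ'd, hΦ'eval, -⟩ := exists_regroup_centred
    (χ₁.comp ((algebraMap (X'.presheaf.stalk p) (blowupAlgebra (Ideal.span (Set.range c)) (c 0))).comp ι)) u hu' Φ hΦd hcen hexact'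
  have hfun : (fun i => χ₁ (blowupAlgebra.frac c 0 i)) = (![1, u 0, u 1] : Fin 3 → X₁.presheaf.stalk p₁) := by
    funext i
    refine Fin.cases ?_ (fun l => ?_) i
    · rw [show blowupAlgebra.frac c 0 0 = 1 from blowupAlgebra.gen_self _ _ _, map_one]
      rfl
    · have hl : l = 0 ∨ l = 1 := by fin_cases l <;> simp
      rcases hl with rfl | rfl <;> rfl
  have hcone : MvPolynomial.eval u Φ' = χ₁ (MvPolynomial.aeval (blowupAlgebra.frac c 0) (MvPolynomial.map ι Φ)) := by
    rw [hΦ'eval, MvPolynomial.map_aeval, MvPolynomial.eval₂Hom_map_hom, hfun, MvPolynomial.aeval_def, MvPolynomial.eval₂_map,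
      MvPolynomial.coe_eval₂Hom]
    exact congrArg (fun F => MvPolynomial.eval₂ F (![1, u 0, u 1] : Fin 3 → X₁.presheaf.stalk p₁) Φ) (RingHom.ext fun _ => rfl)
  refine le_ker_of_stalkIdeal_le_closedPoint sc _ ?_
  rw [hscp, hSt, ← hcone, hker, Ideal.map_sup, Ideal.map_span, Ideal.map_span, Set.image_singleton, Set.image_pair,
    Ideal.span_singleton_le_iff_mem]
  refine Ideal.mem_sup_right ?_
  have hrange : Set.range u = {χ₁ (blowupAlgebra.frac c 0 1), χ₁ (blowupAlgebra.frac c 0 2)} := by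
    ext a
    simp only [Set.mem_range, Set.mem_insert_iff, Set.mem_singleton_iff, u]
    constructor
    · rintro ⟨l, rfl⟩
      have hl : l = 0 ∨ l = 1 := by fin_cases l <;> simp
      rcases hl with rfl | rfl
      · exact Or.inl rfl
      · exact Or.inr rfl
    · rintro (rfl | rfl)
      · exact ⟨0, rfl⟩
      · exact ⟨1, rfl⟩
  rw [← hrange]
  exact eval_mem_span_range_of_isHomogeneous u hΦ'd h1m

end Summit.ResolutionOfSingularities.ResolutionOfSingularities.Cruxes.EquisingularLiftNat.Sections.TCPlus

end
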